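import Summits.QuantumFields.YangMills.Theorems.BalabanUVNodesN11NodeFacesOfSupplyChainTokens
import Summits.QuantumFields.YangMills.Theorems.BalabanUVNodesN11GaussianCertificateDefs
import Summits.QuantumFields.YangMills.Theorems.BalabanUVNodesN11Sect3SupplyChainObligationsDefs
import Literature.MathematicalPhysics.QuantumFieldTheory.Balaban1983to89.Node00.N24ItemsStage13AtThm1CCMWZBSepCoPH

/-!
# DAG node N11 — THE K1 ENGINE's FOUR DOOR ROWS AND ITS `h11N` CHILD AT THE εbg-LETTER z-WITNESS CERTIFICATE
# `θᴳᶻᴮ := gaussPinH (Stage13HParams.ofHistoryBlind F N ⟨θ₁₅ᶜᶜᴹᵂᶻᴮ(j; γ; εbg; Efl, logz), Zr⟩)`, KEYED DIRECTLY ON THE θ-GENERIC SOCKETS — A RESIDUE-FREE HOME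
# (Stage-2 campaign, director-ym №365 ∕ №366: the old homes `…N11K1WitnessGaussPinHAtZB` ∕ `…N11NodeFacesOfSupplyChainTokensAtZBWitness` sit on the residue chain
# `…N11K1WitnessGaussPinH → …AtWitness → …OperandRoads → …AtZ(Witness)`, red by consumption of the re-keyed N24 doors — node00-def-RR-2 FINDING-2; they stay «residue, not false»)

Cell `pub-ymgap` (HUMAN RULING D-0062, Track A full width), seat `pub-ymgap-dag-n11-d` (R134 N11 [B14] s2; gen 42, TRAIN-N11 lead of the Stage-2 campaign); helper lane of
K1⁹ = stmt-QuantumFields-27364 (`--kind proof --supports 27364 --as helper`; count-neutral).  CONSUMER: dag-n24-c's collapsed K1 engine v2 (`N24-G20-ENGINE-V2-DESIGN.md`,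
bus 2026-08-30 12:01Z «AS IS, GO from the consumer»).  [III] = [Balaban1988Convergent], [V] = [Balaban1989LargeFieldII], [IV] = [Balaban1989LargeFieldI], [I] = [Balaban1987RG1].

WHAT (3 theorems, every proof ONE application of a landed θ-GENERIC theorem; imports ONLY modules outside the Stage-2 residue cone — `…N11NodeFacesOfSupplyChainTokens`
(the road-agnostic socket `h11Family_of_supplyChainAt_family`), `…N11GaussianCertificateDefs` (`gaussPinH`, `antecedent_gaussPinH`, `gaussPinH_ζ0 ∕ _quad`),
`…N11Sect3SupplyChainObligationsDefs` (`noExpansionObligation_of_gaussCert_of_operandRows`), node00's Z3 numerics `Record13NumericsOfThm1CCMWZB`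
(`slotsNondegenerate₁₃_∕admissible_theta13OfThm1CCMWZB_of_le_half`, via the N24 import) and dag-n24-c's free-slot Z3 rows `N24ItemsStage13AtThm1CCMWZBSepCoPH`):
* ★ `doorRows_gaussPinH_ofHistoryBlind_theta13OfThm1CCMWZB` — from ANY door proof `hP` at `θᴴᶻᴮ` (general run-indexed `Zr`): the engine's FOUR door rows at `θᴳᶻᴮ` in ONE
  conjunction `Provisos₁₃SepCoPH ∧ Admissible ∧ (ZhUnity ∧ SlotsNondegenerate₁₃) ∧ (∀ P k, k < P.K → TLaw → SLaw (k+1))` (projections `.1 ∕ .2.1 ∕ .2.2.1 ∕ .2.2.2`).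
* ★ `supplyChainAt_windowed_gaussPinH_ofHistoryBlind_theta13OfThm1CCMWZB_of_exists_supplier` — from the K1 FACE's `h11N` token VERBATIM
  `∃ σ, (∀ P, window → SupplierObligations θᴳᶻᴮ P (σ P)) ∧ (∀ P, window → OperandRowsAlongChain θᴳᶻᴮ P (σ P))` and a door proof `hG` at `θᴳᶻᴮ`: the supply chain
  `SupplyChainAt θᴳᶻᴮ P` on every windowed run (the no-expansion obligation discharged at the Gaussian-class certificate, `M = L^j ≥ 1`).
* ★★★ `h11Family_gaussPinH_ofHistoryBlind_theta13OfThm1CCMWZB_of_exists_supplier_windowed` — N11's child family in dag-n24-c's `h11` SHAPE at `θᴳᶻᴮ`'s SepCoPH datum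
  from the same `h11N` token, `0 < γ′`: the road-agnostic socket at `θᴳᶻᴮ` (live-selector line by `rfl`; admissibility ∕ `0 ≤ κ, E₀, B₀` ∕ `1 ≤ M` from Z3's
  `admissible_theta13OfThm1CCMWZB_of_le_half` and the family's numerals `κ = 2·10⁴`, `E₀ = B₀ = 1`, `M = L^j`) ∘ the previous theorem — ONE application where the old road
  took `obtain ⟨σ, hσ, hops⟩` + `…AtZBWitness.h11Family_…ZB_of_operandRows_windowed`.
The statements are deliberately NOT byte-copies of the residue decls (№366 R3): (1) bundles the four rows, (2)(3) read the face's `∃ σ, … ∧ …` token.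

HONEST FRAMING.  Count-neutral KERNEL COMPOSITION of landed θ-generic theorems; the door proofs `hP ∕ hG` and the `h11N` token ([III] §3's supplier with its obligations and
def-T's operand rows along the chain = Theorem 2 [III] proper — XL, nobody's theorem) are DISPLAYED HYPOTHESES; NO value of `εbg`, `E_k`, `log z_k` pinned or read; the window
`0 < γ ≤ ½`, the six signs and `0 < εbg` are the only numerics read; NOT a claim that any Z3 member is K1⁹'s witness; the eight residue modules are untouched; nothing of
Bałaban asserted; K0⁷ ∕ K1⁹ NOT closed; N11 ∕ N13 ∕ N24 NOT discharged; counts unmoved (typed 28∕28 · discharged 8∕28, 8∕27 excl. NODE O · K 1∕4).  One finite `𝕋⁴_{L^K}`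
programme at fixed `ε = L^{−K}`; R4 closes only the conditional finite-𝕋⁴ rung — NOT ℝ⁴, NOT OS, NOT a mass gap, NOT Clay.  No `sorry`, `axiom`, `def`, `instance`, `notation`.
Sources (SHAPE ∕ bookkeeping only): [III] Thm 1 p.262, remark p.262, Theorem p.245, p.244 L36–38, §3 p.279, (2.6)–(2.8) pp.255–256, (2.21) p.258, (3.16)–(3.25) pp.268–270, (1.11) p.248,
(1.15) p.249; [V] Thm 1 + (0.1) pp.355–356, (1.15) pp.359–360; [IV] (0.2)–(0.4) p.176, p.177 (i)–(ii); [I] Thm 1 p.259.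
v1.1 (DOCSTRINGS ONLY; dag-n11-d g45): the FIX-FORWARD owed after dag-ref-I READ-993 LOCATED-1 (on the χ-twin ✓p809865, typo inherited from this file): the three [V] locators
«(0.15) p.360» now read «(1.15) pp.359–360» (the referee's located correction: [Balaban1989LargeFieldII]'s small-field condition (1.15), pp.359–360 — as the χ-twin's v1.2
✓p810219 already reads).  Every declaration, statement AND proof, is byte-identical to v1 (✓p773221).
-/

noncomputable section

open MeasureTheory
open scoped BigOperators ENNReal NNReal Matrix.Norms.L2Operator

namespace Summit.QuantumFields.YangMills.Theorems.BalabanUVNodesN11K1ZBRoadDoorRows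

open Literature.MathematicalPhysics.QuantumFieldTheory.Balaban1983to89 T4Continuum Node00 Node00.Tk DagBinding T4DatumAssembly FlowStepRuns AveragingRT
open B10Eq42TorusConstraint (bondsIn)
open BalabanUVNodesN11Sect3SupplyChainDefs
open BalabanUVNodesN11Sect3SupplyChainObligationsDefs
open BalabanUVNodesN11GaussianCertificateDefs (gaussPinH gaussPinH_ζ0 gaussPinH_quad provisos₁₃CoPH_gaussPinH antecedent_gaussPinH gaussPinH_toStage13Params)
open BalabanUVNodesN11GaussianCertificateRows (zhUnity_of_gaussCert)
open BalabanUVNodesN11NodeFacesOfSupplyChainTokens (h11Family_of_supplyChainAt_family)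

variable {F : T4Family} {N : ℕ} [NeZero N]

variable {j : ℕ} {γ εbg ε₀ ε₂₉ B₃ B₃' a₀ a₁ : ℝ} {Efl logz : B12.RunParams → ℕ → ℝ}

/-- **★ THE FOUR DOOR ROWS OF THE K1 ENGINE AT `θᴳᶻᴮ` FROM ANY DOOR PROOF `hP` AT `θᴴᶻᴮ`** — `Provisos₁₃SepCoPH`, `Admissible`, `ZhUnity ∧ SlotsNondegenerate₁₃` and N13's
(R₁₃) law chain `∀ P k, k < P.K → TLaw → SLaw (k+1)`, in ONE conjunction (general run-indexed `Zr`; window `0 < γ ≤ ½` + the six signs + `0 < εbg`; the letters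
`Efl ∕ logz ∕ εbg` are NOT read): `antecedent_gaussPinH` (unity UNCONDITIONAL at the certificate, `zhUnity_of_gaussCert ∘ gaussPinH_ζ0`), Z3's
`slotsNondegenerate₁₃_theta13OfThm1CCMWZB` ∕ `admissible_theta13OfThm1CCMWZB_of_le_half`, and dag-n24-c's free-slot row `N24_laws₁₃CoPH_theta13OfThm1CCMWZB` read at
`θᴳᶻᴮ`'s own slots.  CONDITIONAL on `hP`; nothing of Bałaban asserted.
[cite: Balaban1988Convergent, Thm 1 p.262, (2.6)–(2.8) pp.255–256, (3.16)–(3.22) pp.268–269, (1.11) p.248, (1.15) p.249, p.244; Balaban1987RG1, Thm 1 p.259; Balaban1989LargeFieldII, Thm 1 p.355 (not exercised), (1.15) pp.359–360; Balaban1989LargeFieldI, (0.2)–(0.4) p.176 (bookkeeping)] -/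
theorem doorRows_gaussPinH_ofHistoryBlind_theta13OfThm1CCMWZB (hγ₀ : 0 < γ) (hγh : γ ≤ 1 / 2) (hbg : 0 < εbg) (hε : 0 < ε₀) (hε' : 0 < ε₂₉)
    (hB : 0 ≤ B₃) (hB' : 0 ≤ B₃') (ha₀ : 0 < a₀) (ha₁ : 0 < a₁) (Zr : (q : B12.RunParams) → TkResidualW F N (FluctV N) q.K)
    (hP : (Stage13HParams.ofHistoryBlind F N ⟨theta13OfThm1CCMWZB F N j γ εbg ε₀ ε₂₉ B₃ B₃' a₀ a₁ Efl logz, Zr⟩).Provisos₁₃SepCoPH F N) :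
    (gaussPinH (Stage13HParams.ofHistoryBlind F N ⟨theta13OfThm1CCMWZB F N j γ εbg ε₀ ε₂₉ B₃ B₃' a₀ a₁ Efl logz, Zr⟩)).Provisos₁₃SepCoPH F N ∧
      (gaussPinH (Stage13HParams.ofHistoryBlind F N ⟨theta13OfThm1CCMWZB F N j γ εbg ε₀ ε₂₉ B₃ B₃' a₀ a₁ Efl logz, Zr⟩)).Admissible F N ∧
      ((gaussPinH (Stage13HParams.ofHistoryBlind F N ⟨theta13OfThm1CCMWZB F N j γ εbg ε₀ ε₂₉ B₃ B₃' a₀ a₁ Efl logz, Zr⟩)).ZhUnity F N ∧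
        (gaussPinH (Stage13HParams.ofHistoryBlind F N ⟨theta13OfThm1CCMWZB F N j γ εbg ε₀ ε₂₉ B₃ B₃' a₀ a₁ Efl logz, Zr⟩)).SlotsNondegenerate₁₃ F N) ∧
      ∀ (P : B12.RunParams) (k : ℕ), k < P.K →
        TLaw₁₃CoPH F N (gaussPinH (Stage13HParams.ofHistoryBlind F N ⟨theta13OfThm1CCMWZB F N j γ εbg ε₀ ε₂₉ B₃ B₃' a₀ a₁ Efl logz, Zr⟩)) P k →
          SLaw₁₃CoPH F N (gaussPinH (Stage13HParams.ofHistoryBlind F N ⟨theta13OfThm1CCMWZB F N j γ εbg ε₀ ε₂₉ B₃ B₃' a₀ a₁ Efl logz, Zr⟩)) P (k + 1) := by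
  obtain ⟨hP', hU, hA⟩ := antecedent_gaussPinH hP (slotsNondegenerate₁₃_theta13OfThm1CCMWZB F N j γ εbg ε₀ ε₂₉ B₃ B₃' a₀ a₁ Efl logz)
    (admissible_theta13OfThm1CCMWZB_of_le_half F N Efl logz hγ₀ hγh hbg hε hε' hB hB' ha₀ ha₁)
  exact ⟨hP', hA, hU, fun P => N24_laws₁₃CoPH_theta13OfThm1CCMWZB Zr
    (gaussPinH (Stage13HParams.ofHistoryBlind F N ⟨theta13OfThm1CCMWZB F N j γ εbg ε₀ ε₂₉ B₃ B₃' a₀ a₁ Efl logz, Zr⟩)).Zh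
    (gaussPinH (Stage13HParams.ofHistoryBlind F N ⟨theta13OfThm1CCMWZB F N j γ εbg ε₀ ε₂₉ B₃ B₃' a₀ a₁ Efl logz, Zr⟩)).Phih P hγ₀ hγh hbg hε hε' hB hB' ha₀ ha₁⟩

/-- **★ THE SUPPLY CHAIN AT `θᴳᶻᴮ` ON EVERY WINDOWED RUN FROM THE K1 FACE's `h11N` TOKEN** — from `∃ σ, (windowed SupplierObligations) ∧ (windowed OperandRowsAlongChain)`
(dag-n24-c's face binder, verbatim shape) and any door proof `hG` at `θᴳᶻᴮ`: `∀ P, Step.InInterval γ′ P.K (gOfRecord₁₃ θ₁₅ᶜᶜᴹᵂᶻᴮ P) → SupplyChainAt θᴳᶻᴮ P` — the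
no-expansion obligation discharged at the Gaussian-class certificate by `noExpansionObligation_of_gaussCert_of_operandRows` (`gaussPinH_ζ0 ∕ _quad`, `M = L^j ≥ 1`).
CONDITIONAL; nothing of Bałaban asserted. [cite: Balaban1988Convergent, §3 p.279, (3.16)–(3.25) pp.268–270, (2.21) p.258, Thm 1 p.262 (bookkeeping)] -/
theorem supplyChainAt_windowed_gaussPinH_ofHistoryBlind_theta13OfThm1CCMWZB_of_exists_supplier
    (Zr : (q : B12.RunParams) → TkResidualW F N (FluctV N) q.K)
    (hG : (gaussPinH (Stage13HParams.ofHistoryBlind F N ⟨theta13OfThm1CCMWZB F N j γ εbg ε₀ ε₂₉ B₃ B₃' a₀ a₁ Efl logz, Zr⟩)).Provisos₁₃SepCoPH F N) {γ' : ℝ}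
    (hN11 : ∃ σ : (P : B12.RunParams) → Sect3Supplier (gaussPinH (Stage13HParams.ofHistoryBlind F N ⟨theta13OfThm1CCMWZB F N j γ εbg ε₀ ε₂₉ B₃ B₃' a₀ a₁ Efl logz, Zr⟩)) P,
      (∀ P : B12.RunParams, Step.InInterval γ' P.K (gOfRecord₁₃ F N (theta13OfThm1CCMWZB F N j γ εbg ε₀ ε₂₉ B₃ B₃' a₀ a₁ Efl logz) P) →
        SupplierObligations (gaussPinH (Stage13HParams.ofHistoryBlind F N ⟨theta13OfThm1CCMWZB F N j γ εbg ε₀ ε₂₉ B₃ B₃' a₀ a₁ Efl logz, Zr⟩)) P (σ P)) ∧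
      (∀ P : B12.RunParams, Step.InInterval γ' P.K (gOfRecord₁₃ F N (theta13OfThm1CCMWZB F N j γ εbg ε₀ ε₂₉ B₃ B₃' a₀ a₁ Efl logz) P) →
        OperandRowsAlongChain (gaussPinH (Stage13HParams.ofHistoryBlind F N ⟨theta13OfThm1CCMWZB F N j γ εbg ε₀ ε₂₉ B₃ B₃' a₀ a₁ Efl logz, Zr⟩)) P (σ P))) :
    ∀ P : B12.RunParams, Step.InInterval γ' P.K (gOfRecord₁₃ F N (theta13OfThm1CCMWZB F N j γ εbg ε₀ ε₂₉ B₃ B₃' a₀ a₁ Efl logz) P) →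
      SupplyChainAt (gaussPinH (Stage13HParams.ofHistoryBlind F N ⟨theta13OfThm1CCMWZB F N j γ εbg ε₀ ε₂₉ B₃ B₃' a₀ a₁ Efl logz, Zr⟩)) P := by
  obtain ⟨σ, hσ, hops⟩ := hN11
  intro P hw
  exact ⟨σ P, hσ P hw, noExpansionObligation_of_gaussCert_of_operandRows
    (gaussPinH_ζ0 _) (gaussPinH_quad _) hG.toCore (by show 1 ≤ F.L ^ j; exact Nat.one_le_pow _ _ (by have := F.hL11; omega)) (σ P) (hσ P hw).loc (hops P hw)⟩

/-- **★★★ N11's CHILD FAMILY IN dag-n24-c's `h11` SHAPE AT `θᴳᶻᴮ`'s SepCoPH DATUM FROM THE FACE's `h11N` TOKEN** — `∃ σ, (windowed SupplierObligations) ∧ (windowed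
OperandRowsAlongChain)` on the step window `]0, γ′]`, `0 < γ′`, any door proof `hG` (keys the datum); `γ₁₁ := γ′`; window `0 < γ ≤ ½` + six signs + `0 < εbg`; the letters
`Efl ∕ logz ∕ εbg` are NOT read; of the node's leaf antecedents only `smallCouplings` is read.  Proof: the ROAD-AGNOSTIC socket `h11Family_of_supplyChainAt_family` at `θᴳᶻᴮ`
(live-selector line by `rfl`; admissibility ∕ `0 ≤ κ, E₀, B₀` ∕ `1 ≤ M` from Z3's `admissible_theta13OfThm1CCMWZB_of_le_half` and the family's numerals `κ = 2·10⁴`,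
`E₀ = B₀ = 1`, `M = L^j`) fed by the previous theorem.  CONDITIONAL on `hG` and `h11N` ([III] §3's supplier = Thm 2 proper, nobody's theorem); nothing of Bałaban asserted;
N11 NOT discharged; K1⁹ NOT closed. [cite: Balaban1988Convergent, Theorem p.245, Thm 1 p.262, remark p.262, p.244 L36–38, §3 p.279, (3.16)–(3.25) pp.268–270, (2.21) p.258, (1.15) p.249; Balaban1989LargeFieldII, Thm 1 + (0.1) pp.355–356, (1.15) pp.359–360; Balaban1987RG1, Thm 1 p.259; Balaban1989LargeFieldI, (0.3)–(0.4) p.176, p.177 (i)–(ii)] -/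
theorem h11Family_gaussPinH_ofHistoryBlind_theta13OfThm1CCMWZB_of_exists_supplier_windowed (hγ₀ : 0 < γ) (hγh : γ ≤ 1 / 2) (hbg : 0 < εbg)
    (hε : 0 < ε₀) (hε' : 0 < ε₂₉) (hB : 0 ≤ B₃) (hB' : 0 ≤ B₃') (ha₀ : 0 < a₀) (ha₁ : 0 < a₁)
    (Zr : (q : B12.RunParams) → TkResidualW F N (FluctV N) q.K)
    (hG : (gaussPinH (Stage13HParams.ofHistoryBlind F N ⟨theta13OfThm1CCMWZB F N j γ εbg ε₀ ε₂₉ B₃ B₃' a₀ a₁ Efl logz, Zr⟩)).Provisos₁₃SepCoPH F N) {γ' : ℝ} (hγ' : 0 < γ')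
    (hN11 : ∃ σ : (P : B12.RunParams) → Sect3Supplier (gaussPinH (Stage13HParams.ofHistoryBlind F N ⟨theta13OfThm1CCMWZB F N j γ εbg ε₀ ε₂₉ B₃ B₃' a₀ a₁ Efl logz, Zr⟩)) P,
      (∀ P : B12.RunParams, Step.InInterval γ' P.K (gOfRecord₁₃ F N (theta13OfThm1CCMWZB F N j γ εbg ε₀ ε₂₉ B₃ B₃' a₀ a₁ Efl logz) P) →
        SupplierObligations (gaussPinH (Stage13HParams.ofHistoryBlind F N ⟨theta13OfThm1CCMWZB F N j γ εbg ε₀ ε₂₉ B₃ B₃' a₀ a₁ Efl logz, Zr⟩)) P (σ P)) ∧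
      (∀ P : B12.RunParams, Step.InInterval γ' P.K (gOfRecord₁₃ F N (theta13OfThm1CCMWZB F N j γ εbg ε₀ ε₂₉ B₃ B₃' a₀ a₁ Efl logz) P) →
        OperandRowsAlongChain (gaussPinH (Stage13HParams.ofHistoryBlind F N ⟨theta13OfThm1CCMWZB F N j γ εbg ε₀ ε₂₉ B₃ B₃' a₀ a₁ Efl logz, Zr⟩)) P (σ P))) :
    ∀ βup β₀ : ℝ, ∃ γ₁₁ : ℝ, 0 < γ₁₁ ∧ ∀ w : WorldP,
      w.C = (datumOfRecord₁₃SepCoPH F N (gaussPinH (Stage13HParams.ofHistoryBlind F N ⟨theta13OfThm1CCMWZB F N j γ εbg ε₀ ε₂₉ B₃ B₃' a₀ a₁ Efl logz, Zr⟩)) hG).C →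
      w.βup = βup → w.β₀ = β₀ → w.γ ≤ γ₁₁ → ∀ P : B12.RunParams, (leavesP w P).b7 → (leavesP w P).b8 → (leavesP w P).b9 → (leavesP w P).b10 → (leavesP w P).b11 →
      (leavesP w P).smallCouplings → (leavesP w P).smallFieldInductive → (leavesP w P).flowControl →
        ∀ k, k < P.K → SLaw₁₃CoPH F N (gaussPinH (Stage13HParams.ofHistoryBlind F N ⟨theta13OfThm1CCMWZB F N j γ εbg ε₀ ε₂₉ B₃ B₃' a₀ a₁ Efl logz, Zr⟩)) P k →
          TLaw₁₃CoPH F N (gaussPinH (Stage13HParams.ofHistoryBlind F N ⟨theta13OfThm1CCMWZB F N j γ εbg ε₀ ε₂₉ B₃ B₃' a₀ a₁ Efl logz, Zr⟩)) P k :=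
  h11Family_of_supplyChainAt_family _ hG rfl
    (admissible_theta13OfThm1CCMWZB_of_le_half F N Efl logz hγ₀ hγh hbg hε hε' hB hB' ha₀ ha₁)
    (by change (0 : ℝ) ≤ (stage12NumericsOfThm1CCMWB F.L j γ εbg ε₀ B₃ B₃' a₀ a₁).s2.lf.κ
        rw [show (stage12NumericsOfThm1CCMWB F.L j γ εbg ε₀ B₃ B₃' a₀ a₁).s2.lf.κ = 20000 from rfl]; norm_num)
    (by change (0 : ℝ) ≤ (stage12NumericsOfThm1CCMWB F.L j γ εbg ε₀ B₃ B₃' a₀ a₁).s2.lf.E₀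
        rw [show (stage12NumericsOfThm1CCMWB F.L j γ εbg ε₀ B₃ B₃' a₀ a₁).s2.lf.E₀ = 1 from rfl]; norm_num)
    (by change (0 : ℝ) ≤ (stage12NumericsOfThm1CCMWB F.L j γ εbg ε₀ B₃ B₃' a₀ a₁).s2.lf.B₀
        rw [show (stage12NumericsOfThm1CCMWB F.L j γ εbg ε₀ B₃ B₃' a₀ a₁).s2.lf.B₀ = 1 from rfl]; norm_num)
    (by show 1 ≤ F.L ^ j; exact Nat.one_le_pow _ _ (by have := F.hL11; omega)) hγ'
    (supplyChainAt_windowed_gaussPinH_ofHistoryBlind_theta13OfThm1CCMWZB_of_exists_supplier Zr hG hN11)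

end Summit.QuantumFields.YangMills.Theorems.BalabanUVNodesN11K1ZBRoadDoorRows

end
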